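import Mathlib.Data.Nat.Log
import Literature.Computability.Complexity.Classes
import Literature.Computability.Complexity.Nondeterministic
import Literature.Computability.Complexity.CNF
import Literature.Computability.Complexity.Promise
import Literature.Computability.Complexity.PCP
import HarnessLib

-- provenance: harness21/H21/H21/Statements/PNP/Approximation.lean @ 7fbbdec (interim HEAD d8f2665); M5 mechanical rewrite
/-!
# P vs NP: the PCP theorem and optimal inapproximability of E3-SAT

Family `pnp` (trunk `CplxCore`), statements **pnp.S35** and **pnp.S36**.

* **pnp.S35** (PCP theorem). `NP = ⋃_{c, q} PCP(c log n + c, q)`: every NP language has a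
  polynomial-time probabilistic verifier that uses `O(log n)` random bits and reads `O(1)`
  bits of the proof [Arora–Safra 1998, Thm 1.2.2.1; Arora–Lund–Motwani–Sudan–Szegedy 1998,
  Thm 4; Arora–Barak 2009, Thm 11.5].  Vendored as the named fact `pcp_theorem_exact` over the
  class `PCPExact` (verifiers run with *exactly* `r n` coins).  The first rendering
  `pcp_theorem : NP = ⋃_{c,q} PCP(c log₂ n + c, q)` (over `PCP`, coin count only *bounded* by
  `r n`) is refuted as stated — `pcp_theorem_false` in `PCPSubsetNP.lean`, which states the
  negation of its literal text — and has been retired from this file (it was never a hypothesis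
  of anything in the tree).
* **pnp.S36** (Håstad's `7/8 + ε` theorem). For every `ε > 0` the promise problem
  `gapE3SAT ε` — yes-instances: satisfiable E3-CNFs; no-instances: E3-CNFs in which every
  assignment satisfies at most a `7/8 + ε` fraction of the clauses — is NP-hard
  [Håstad, *Some optimal inapproximability results*, J. ACM 48 (2001), Thm 6.5].

## Design

* `PCP r q` (file `PCP.lean`) has explicit coin/query bounds; the class `PCP(O(log n), O(1))`
  of the PCP theorem was first rendered as the set of languages lying in
  `PCP (fun n => c * Nat.log 2 n + c) (fun _ => q)` for some constants `c q : ℕ`, matching the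
  easy inclusion `PCP_log_const_subset_NP` of that file.  **Both are refuted as stated**
  (`PCPSubsetNP.lean`: `PCP_log_const_subset_NP_false`, `pcp_theorem_false`): a `PCPVerifier`
  carries its coin count as a bare function `coins : ℕ → ℕ`, `PCP r q` only asks `coins n ≤ r n`,
  and the acceptance probability is taken over coin strings of length exactly `coins |x|` — so an
  uncomputable `coins ≤ 1·log n + 1` encodes an arbitrary set of input lengths and puts
  uncountably many languages into `PCP(log n, 0)`, while `NP` is countable.  In Arora–Barak's
  Def. 11.4 the verifier "uses at most `r(n)` random coins" of its own tape, so its acceptance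
  probability is the same over `{0,1}^{r(n)}` (the `2^{r(n)}` strings enumerated in Remark
  11.6(3)); in this model that is a verifier run with *exactly* `r n` coins.  Hence the corrected
  class `PCPExact r q` (`coins n = r n`, everything else as in `PCP r q`) and the corrected fact
  `pcp_theorem_exact : NP = ⋃_{c,q} PCPExact(c log₂ n + c, q)`, whose inclusion `⊇` is exactly the
  tree's proved `PCP_log_const_subset_NP_exact_holds` (`PCPSubsetNP.lean`, which imports this
  file — so the glue `pcp_theorem_exact_of` takes that statement as a hypothesis instead of
  importing it) and whose inclusion `⊆` is the PCP theorem proper (Arora–Barak Ch. 22).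
* `gapE3SAT ε` is built with `PromiseProblem.ofEncoding encodingCNF` from the two sets of
  CNFs over `ℕ`-indexed variables; E3-CNFs are `CNF.IsExactWidth 3` (every clause has exactly
  three literals on three distinct variables, as in Håstad 2001, §2) and the MAX-SAT value is
  `CNF.maxSatFraction : ℚ` (file `Literature.Prelude.CplxCore.CNF`).  NP-hardness of a promise
  problem is `PromiseProblem.IsNPHard` (file `Literature.Prelude.CplxCore.Promise`).
* Junk value (review F13a): `CNF.maxSatFraction [] = 1`, and the empty CNF is a (vacuous)
  E3-CNF, so for `ε ≥ 1/8` the empty formula is both a yes- and a no-instance.  The sanity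
  lemma `gapE3SAT_disjoint` therefore assumes `ε < 1/8`; Håstad's theorem is stated for all
  `ε > 0` as in print (for `ε ≥ 1/8` it is trivially true anyway).
* Mathlib has no PCP, MAX-SAT or promise-problem material (searched `PCP`, `MaxSat`,
  `PromiseProblem`, `inapprox`); nothing is duplicated.
-/

namespace Literature.Computability.Complexity

open _root_.Computability

/-! ### The PCP theorem -/

/-- `PCPExact r q`: the languages `L ⊆ {0,1}*` having a nonadaptive polynomial-time PCP verifier
(`PCPVerifier.IsPolyTime`) that on inputs of length `n` is run with *exactly* `r n` coins
(`V.coins n = r n`) and makes at most `q n` queries, with perfect completeness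
(`x ∈ L → ∃ π, Pr_ρ[accept] = 1`) and soundness error `1/2` (`x ∉ L → ∀ π, Pr_ρ[accept] ≤ 1/2`),
the probability being over uniform `ρ ∈ {0,1}^{r n}`.  This is the class `PCP r q` of `PCP.lean`
with its coin condition `V.coins n ≤ r n` replaced by equality — the reading of Arora–Barak's
Def. 11.4 ("V uses at most `r(n)` random coins"; acceptance probability over V's own coin tosses,
i.e. over the `2^{r(n)}` strings enumerated in Remark 11.6(3)) under which the easy inclusion
`PCP(log n, 1) ⊆ NP` holds in this model (`PCP_log_const_subset_NP_exact_holds`,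
`PCPSubsetNP.lean`); with `≤` an uncomputable coin count makes the class uncountable
(`PCPCoins.lengthSet_mem_PCP`, ibid.).  As for every resource-bounded class the bound `r` is
meant to be a constructible function; it is used below with `r n = c · log₂ n + c`.  A verifier
using fewer coins is padded to exactly `r n` coins by ignoring the surplus, which does not change
its acceptance probabilities, so for constructible `r` nothing is lost against Def. 11.4.
[Arora–Barak 2009, Def. 11.4 and Remark 11.6(3); Arora–Safra 1998, Def. 2.2]
[cite: AroraBarakCC2009, Def. 11.4] -/
def PCPExact (r q : ℕ → ℕ) : Set (Language Bool) :=
  {L | ∃ V : PCPVerifier, V.IsPolyTime ∧ (∀ n, V.coins n = r n) ∧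
    (∀ x ρ, (V.queries x ρ).length ≤ q x.length) ∧
    (∀ x ∈ L, ∃ π, V.acceptProb x π = 1) ∧
    (∀ x ∉ L, ∀ π, V.acceptProb x π ≤ 1 / 2)}

/-- `PCPExact r q ⊆ PCP r q`: a verifier run with exactly `r n` coins uses at most `r n` coins.
[Arora–Barak 2009, Def. 11.4] [cite: AroraBarakCC2009, Def. 11.4] -/
theorem PCPExact_subset_PCP (r q : ℕ → ℕ) : PCPExact r q ⊆ PCP r q := by
  rintro L ⟨V, hV, hc, hl, hcomp, hsound⟩
  exact ⟨V, hV, fun n => (hc n).le, hl, hcomp, hsound⟩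

/-- `PCPExact r q` is monotone in the query bound (the coin count is pinned to `r`).
[Arora–Barak 2009, §11.2 (immediate from Def. 11.4)] [cite: AroraBarakCC2009, §11.2] -/
theorem PCPExact_mono_right (r : ℕ → ℕ) {q q' : ℕ → ℕ} (hq : ∀ n, q n ≤ q' n) :
    PCPExact r q ⊆ PCPExact r q' := by
  rintro L ⟨V, hV, hc, hl, hcomp, hsound⟩
  exact ⟨V, hV, hc, fun x ρ => (hl x ρ).trans (hq _), hcomp, hsound⟩

/-- **pnp.S35** (PCP theorem) — corrected rendering. `NP = PCP(log n, 1)`: a language is in `NP`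
iff it has a nonadaptive polynomial-time PCP verifier that on inputs of length `n` is run with
exactly `c · log₂ n + c` coins and makes at most `q` queries, for some constants `c, q`, with
perfect completeness and soundness error `1/2`; i.e. `NP = ⋃_{c,q} PCPExact(c log₂ n + c, q)`.
Printed (Arora–Barak 2009, Thm 11.5, "The PCP Theorem [AS92, ALM⁺92]"): `NP = PCP(log n, 1)`,
where `L ∈ PCP(r(n), q(n))` iff `L` has a `(c · r(n), d · q(n))`-PCP verifier for some constants
`c, d > 0` (Def. 11.4: polynomial-time, at most `r(n)` coins, at most `q(n)` nonadaptive queries,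
completeness `1`, soundness `1/2`).  The coin budget `c log₂ n + c` (rather than `c log n`) only
absorbs the inputs of length `≤ 1` and the base of the logarithm; the classes coincide.  The
inclusion `⊇` is Remark 11.6(3), proved in the tree as `PCP_log_const_subset_NP_exact_holds`
(`PCPSubsetNP.lean`; see `pcp_theorem_exact_of`); the inclusion `⊆` is the PCP theorem proper
(Arora–Safra 1998, Thm 1.2.2.1 / Arora et al. 1998, Thm 4; Dinur's proof: Arora–Barak Ch. 22,
Lemmas 22.4–22.6) and is what remains unproved here.
[Arora–Barak 2009, Thm 11.5 with Def. 11.4 and Remark 11.6(3); Arora–Safra, J. ACM 45 (1998),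
Thm 1.2.2.1; Arora–Lund–Motwani–Sudan–Szegedy, J. ACM 45 (1998), Thm 4]
[cite: AroraBarakCC2009, Thm 11.5] -/
def pcp_theorem_exact : Prop :=
  Nondeterministic.NP =
    {L | ∃ c q : ℕ, L ∈ PCPExact (fun n => c * Nat.log 2 n + c) (fun _ => q)}

/-- Glue for `pcp_theorem_exact`: the equality follows from the easy inclusion
`⋃_{c,q} PCPExact(c log₂ n + c, q) ⊆ NP` — hypothesis `heasy`, stated verbatim as the tree's named
fact `PCP_log_const_subset_NP_exact`, which is proved (`PCP_log_const_subset_NP_exact_holds`) in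
`PCPSubsetNP.lean`; that file imports this one, so the statement is taken as a hypothesis here
rather than imported — together with the hard inclusion `NP ⊆ ⋃_{c,q} PCPExact(c log₂ n + c, q)`
(the PCP theorem proper, Arora–Barak Thm 11.5 / Ch. 22).
[Arora–Barak 2009, Thm 11.5 and Remark 11.6(3)] [cite: AroraBarakCC2009, Thm 11.5] -/
theorem pcp_theorem_exact_of
    (heasy : ∀ (c q : ℕ) (V : PCPVerifier) (L : Language Bool),
      V.IsPolyTime → (∀ n, V.coins n = c * Nat.log 2 n + c) →
      (∀ x ρ, (V.queries x ρ).length ≤ q) →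
      (∀ x ∈ L, ∃ π, V.acceptProb x π = 1) → (∀ x ∉ L, ∀ π, V.acceptProb x π ≤ 1 / 2) →
      L ∈ Nondeterministic.NP)
    (hhard : Nondeterministic.NP ⊆
      {L | ∃ c q : ℕ, L ∈ PCPExact (fun n => c * Nat.log 2 n + c) (fun _ => q)}) :
    pcp_theorem_exact := by
  refine Set.Subset.antisymm hhard ?_
  rintro L ⟨c, q, V, hV, hc, hq, hcomp, hsound⟩
  exact heasy c q V L hV hc hq hcomp hsound

/-- Conversely, `pcp_theorem_exact` yields the hard inclusion: every `L ∈ NP` has a verifier run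
with exactly `c log₂ n + c` coins making at most `q` queries, for some constants `c, q`.
[Arora–Barak 2009, Thm 11.5] [cite: AroraBarakCC2009, Thm 11.5] -/
theorem pcp_theorem_exact.NP_subset (h : pcp_theorem_exact) :
    Nondeterministic.NP ⊆
      {L | ∃ c q : ℕ, L ∈ PCPExact (fun n => c * Nat.log 2 n + c) (fun _ => q)} :=
  fun _ hL => h ▸ hL

/-! ### Gap-E3SAT and Håstad's `7/8 + ε` theorem -/

/-- `gapE3SAT ε`: the promise problem whose yes-instances are (encodings of) satisfiable
E3-CNFs and whose no-instances are E3-CNFs `φ` with MAX-SAT value `val(φ) ≤ 7/8 + ε`, i.e.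
no assignment satisfies more than a `7/8 + ε` fraction of the clauses.  A uniformly random
assignment satisfies `7/8` of the clauses of any E3-CNF in expectation, so `7/8` is the
trivial approximation threshold. [Håstad 2001, §2 (Max-E3-Sat) and Thm 6.5;
Arora–Barak 2009, §11.2 and §22.4] [cite: Hastad2001, §2 (Max-E3-Sat] -/
def gapE3SAT (ε : ℚ) : PromiseProblem :=
  PromiseProblem.ofEncoding encodingCNF
    {φ : CNF ℕ | φ.IsExactWidth 3 ∧ φ.Satisfiable}
    {φ : CNF ℕ | φ.IsExactWidth 3 ∧ φ.maxSatFraction ≤ 7 / 8 + ε}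

/-- The yes-instances of `gapE3SAT ε` form the language `EkSAT 3` of satisfiable E3-CNFs.
[Håstad 2001, §2] [cite: Hastad2001, §2] -/
@[simp] theorem gapE3SAT_yes (ε : ℚ) : (gapE3SAT ε).yes = EkSAT 3 := rfl

/-- The no-instances of `gapE3SAT ε` are the encodings of E3-CNFs with `val(φ) ≤ 7/8 + ε`.
[Håstad 2001, §2] [cite: Hastad2001, §2] -/
@[simp] theorem gapE3SAT_no (ε : ℚ) :
    (gapE3SAT ε).no =
      encodingCNF.toLanguage {φ : CNF ℕ | φ.IsExactWidth 3 ∧ φ.maxSatFraction ≤ 7 / 8 + ε} :=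
  rfl

/-- Sanity (review F13a): for `ε < 1/8` the promise problem `gapE3SAT ε` is disjoint, since a
satisfiable CNF has `val(φ) = 1 > 7/8 + ε` (`CNF.maxSatFraction_eq_one_iff`).  The hypothesis
is needed: `val([]) = 1` and `[]` is a satisfiable E3-CNF, so for `ε ≥ 1/8` the empty formula
lies on both sides. [Håstad 2001, §2; H21 `CNF.maxSatFraction_nil`] [cite: Hastad2001, §2] -/
def gapE3SAT_disjoint : Prop :=
  ∀ (ε : ℚ) (hε : ε < 1 / 8),
    Disjoint (gapE3SAT ε).yes (gapE3SAT ε).no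

/- interim proof relied on results that are now named facts (D-0014); demoted to a fact by the M5 import, proof preserved:
:= by
  refine PromiseProblem.disjoint_ofEncoding encodingCNF (Set.disjoint_left.2 ?_)
  rintro φ ⟨-, hsat⟩ ⟨-, hval⟩
  have h1 : φ.maxSatFraction = 1 := (CNF.maxSatFraction_eq_one_iff φ).2 hsat
  rw [h1] at hval
  linarith
-/

/-- **pnp.S36** (Håstad's optimal inapproximability of Max-E3-SAT). For every `ε > 0` it is
NP-hard to distinguish satisfiable E3-CNF formulas from E3-CNF formulas in which at most a
`7/8 + ε` fraction of the clauses can be simultaneously satisfied: every `L ∈ NP`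
polynomial-time reduces (as a promise problem) to `gapE3SAT ε`.  Printed (Håstad 2001,
Thm 6.5): "For any `ε > 0` it is NP-hard to distinguish satisfiable E3-CNF formulas from
`(7/8 + ε)`-satisfiable E3-CNF formulas."  This is the *perfect-completeness* statement, proved
only in Håstad's paper (§6.1, Test `F3S^δ(u)`, Lemmas 6.12–6.13, on top of the PCP theorem and
Raz's parallel repetition theorem); Arora–Barak 2009, Thm 22.16 (3-bit PCP with completeness
`1 - δ`) and Cor. 22.17 give only the variant "`(1 - δ)`-satisfiable vs. `(7/8 + ε)`-satisfiable".
[Håstad, *Some optimal inapproximability results*, J. ACM 48 (2001), §2 (Def. 2.2–2.4, 2.17) and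
Thm 6.5; cf. Arora–Barak 2009, Thm 22.16 and Cor. 22.17] [cite: Hastad2001, Thm 6.5] -/
def hastad_seven_eighths : Prop :=
  ∀ (ε : ℚ) (hε : 0 < ε),
    (gapE3SAT ε).IsNPHard

/- Consequence for polynomial-time algorithms (formerly the named fact
`NP_subset_P_of_gapE3SAT_mem_PromiseP` of this file: "for `0 < ε`, if `gapE3SAT ε ∈ PromiseP` then
`NP ⊆ P`", an H21 corollary demoted to a fact by the M5 import because its one-line proof used
the then-unproved `hastad_seven_eighths`).  It is Thm 6.5 *reworded* through the definition of
NP-hardness (Håstad 2001, Thm 6.5, second sentence, with Def. 2.16–2.17; Arora–Barak 2009, §11.2,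
remark after Cor. 11.10), not a separate published result, so it is no longer carried as a named
fact of its own (D-0026 review): it is the proved conditional theorem
`NP_subset_P_of_gapE3SAT_mem_PromiseP_of_hastad_seven_eighths (h : hastad_seven_eighths) {ε : ℚ}
(hε : 0 < ε) (hP : gapE3SAT ε ∈ PromiseP) : Nondeterministic.NP ⊆ Classes.P` of
`ApproximationProofs.lean` (via `PromiseProblem.NP_subset_P_of_isNPHard_of_mem_PromiseP_holds`),
unconditional as soon as `hastad_seven_eighths` is proved; for `1/8 ≤ ε` its hypothesis is
impossible (`gapE3SAT_not_mem_PromiseP_of_le`, ibid.). -/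

end Literature.Computability.Complexity
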